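import Summits.QuantumFields.YangMills.Theorems.BalabanUVNodesN22AtRecordOfKernelFadingSector
import Summits.QuantumFields.YangMills.Theorems.BalabanUVNodesN22AtRecordOfOutputCoordHoloPrinted
import Summits.QuantumFields.YangMills.Theorems.BalabanUVNodesN22KernelLimitOfTwoPointGeneratingLetters

/-!
# NODE N22 (NE9) — THE REAL-SMOOTH (print-shape, possibility-1) PRODUCER OF THE KERNEL-FADING ROAD's HONEST INTERFACE, AT THE RECORD, IN PRINT-LEVEL CURRENCY: K3's `h9` WITH
# THE RECORD's GEOMETRIC MODULI and the N22 pin face from node N18's kernel step rate + `C^{1,1}` dependence of the (2.13) terms on each young coupling ON THE REAL INTERVAL `]0, γ]`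
# ([I] p. 263 «E^{(j)}(X, g_{j−1}, …) is a C^∞-function of g_{j−1} ∈ [0, γ]» read quantitatively — NO complex extension in the couplings at all) + the printed output bound (1.18) +
# PRINTED (2.38) + PRINTED `AnalyticH` + holomorphic configuration readings + p. 282 tails + W1-20's law + (1.21) ∕ (G≈)

Cell `pub-ymgap`, Track A (HUMAN RULING D-0062), WIDTH SEAT `dag-n22-w5` (g2, harness re-seat of base w5) on node n22 = NE9, D-0154 (3a) second width wave;
`--kind proof --supports stmt-QuantumFields-27366 --as helper` (KEY MAP v2: K3⁸ `SpineGivenEndpointR13SepCoPHV`, skeleton v6 b4e55110ab73e679, §2b socket `h9` = K3⁷ v5's verbatim),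
COUNT-NEUTRAL; THEOREMS ONLY (0 `def`, 0 `sorry`, standard axioms).  CLAIM-3 on the bus (self-located in the print-level lane; dag-n22-c g15's word governs the J-road).
CONTEXT.  dag-n22-c g15's J45 ∕ J46 (p638030 ∕ p639523) re-keyed the kernel-fading road on its HONEST INTERFACE — a TERM-LEVEL SECOND-DIFFERENCE LETTER `hΔ`
(`‖E(X; g∣g_i:=t+d) − 2E(X; g∣g_i:=t) + E(X; g∣g_i:=t−d)‖ ≤ M₂·e^{−κ_E d_{k+1}(X)}·d²`, J46 §2 `ne9_EA_objectsOfRecord₁₃_of_kernelStepRate_termSecondDiff_outputBound`) — and named its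
three producers (INBOX 2026-08-28T13:20Z; J46 §1 docstring): J39 §1 (ONE-radius holomorphy — possibility-2 typing, A6 self-flagged for the term of record), J45 §1 (SECTOR holomorphy with
quadratic vanishing — possibility 1; J46 §3, print-level edition p639775 in this lineage) and «print's REAL `C²`∕`C^∞` clause ([I] p. 263)».  THIS FILE types the third producer and its
record edition: §0 ★ `norm_secondDiff_le_of_derivLipschitz` — for `f : ℝ → ℂ` differentiable on `[t − d, t + d]` with an `L`-Lipschitz derivative there,
`‖f(t+d) − 2f(t) + f(t−d)‖ ≤ L·d²` (the symmetrised curve `s ↦ f(t+s) + f(t−s) − 2f(t)` has derivative `f′(t+s) − f′(t−s)` of norm `≤ 2Ls`; Mathlib's fencing lemma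
`image_norm_le_of_norm_deriv_right_le_deriv_boundary` against `s ↦ L s²`); NO holomorphy, NO complex coupling anywhere — the possibility-1 PRINT SHAPE of the coupling dependence
([I] p. 263: «C^∞-function of g_{j−1} ∈ [0, γ]»; dag-n22-c's J47 witness has the `C^∞`, flat-at-zero real trace `t² · expNegInvGlue t`).  §1 feeds J46 §2 with `hΔ` PRODUCED by §0
from the REAL `C^{1,1}` DATUM `hC11` («for every torus ∕ level ∕ young coordinate `i ≤ k` ∕ box history ∕ `X` ∕ admissible `φ`: `t ↦ E^{(k+1)}(X; g∣g_i:=t; φ)` is differentiable on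
`]0, θ.γ]` with an `L·e^{−κ_E d_{k+1}(X)}`-Lipschitz derivative», `M₂ := L`) and with J46's structural binder `hEhol` (term holomorphy through the CONFIGURATION readings) DISCHARGED by this
lineage's p621851 §0 `differentiableOn_E_comp_of_printedSlots` from PRINTED (2.38) + numerals + PRINTED `AnalyticH` + holomorphic readings with dag-n22-w3's sub-polymer clause on `U`
(J46's ball clause := `ball_mem_sp_of_spaceClause`); §2 discharges the (1.21) letter by dag-n22-w3 g4's `polLimitsExistOfRecord₁₃_of_twoPointGenerating` (p616912 §3) — the (G≈)-keyed
twins, numerals `0 < κ ≤ r₁`, `κ₀(64,8) ≤ κ∕4`.  One application each after §0; nothing of J38–J47 ∕ p621851 ∕ p616912 is re-declared.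

WHAT.  §0 ★ `norm_secondDiff_le_of_derivLipschitz` (Mathlib-only real analysis).  §1 ★★★ `ne9_EA_objectsOfRecord₁₃_of_kernelStepRate_derivLipschitz_analyticH` ∕ ★★★
`n22At_rateCarriers_of_kernels_pin_of_kernelStepRate_derivLipschitz_analyticH` — `NE9 ((objectsOfRecord₁₃ F N θ ℓ).EA 0) (Window θ.γ) ℓ.κ ℓ.moduli` and `N22At (rateCarriersOfRecord₁₃CoPH
𝔯 F θ hP g₀ os k).u3` (every `k`, under `hpin`) from: `ℓ.Signs`, `0 < θ.γ`; node N18's `KernelStepRateOfRecord₁₃ F N θ κ₅ ℓ.θ₅ C₅`; W1-20's law; the REAL `C^{1,1}` datum `hC11`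
(letter `L ≥ 0`, rate `κ_E`) on general space tables `sp`; the printed-type OUTPUT bound `hbd` ((1.18) at level `k + 1`, letter `B`); PRINTED (2.38) `Bound238 (box θ.γ k) (sp K k) A R` and
PRINTED `AnalyticH (box θ.γ k) (sp K k)` with Road 1's numerals; holomorphic complexified probe readings on `U K k X ⊇ ball 0 r` (chart clause, sub-polymer space clause on `U`); site weights with
tails (`B₃`, `δ₀ > 0`); `2κ₀(64,8) ≤ κ ≤ κ_E`; `PolLimitsExistOfRecord₁₃ F N θ`; rows `δ₁ ≤ κ₅`, `0 < ℓ.ω`, `ℓ.θ₅ ≤ ℓ.ω²`, `ℓ.κ ≤ δ₁`,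
`(4·(2C₅∕(1−ℓ.θ₅) + 2E₁)∕θ.γ + C₂·θ.γ∕2)∕ℓ.ω ≤ ℓ.C₉` with `E₁ = (16BB₃²∕r²)e^{12Mδ₁}K₀K₁`, `C₂ = (16LB₃²∕r²)e^{12Mδ₁}K₀K₁`.  §2 ★★★ the `_twoPointGenerating` twins: `hlim` DISCHARGED
(+ the small∕near class `lo` with its threshold clause + the bidisc radius `0 < r₂`, `(2B₃+1) r₂ ≤ r` + (G≈) at rate `0 ≤ r₀ < 1`).  NO holomorphy-in-the-coupling hypothesis, NO
term-holomorphy-through-the-readings hypothesis (and in §2 NO (1.21) letter) is displayed.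
THE N22 ROW SENTENCE IN PRINT's OWN SHAPE: «N18's kernel step rate + REAL `C^{1,1}` dependence of the (2.13) terms on each young coupling with an `e^{−κ_E d}`-weighted Lipschitz constant
for the derivative + printed (1.18) + printed (2.38) + printed configuration analyticity + holomorphic minimizer readings + p. 282 tails + W1-20's law + (1.21) [resp. (G≈)] + letter rows
⇒ K3's `h9` ∕ `N22At` with the record's GEOMETRIC moduli, every run length».

HONEST FRAMING (binding).  Count-neutral COMPOSITION of landed theorems by name + one elementary real-analysis lemma; NO estimate of Bałaban's is proved or asserted; every displayed
input is a HYPOTHESIS with its owner (N18's kernel step rate: node N18 — NE5 NOT PRINTED for d = 4; the `C^{1,1}` datum in EVERY young coupling with the uniform weighted constant: the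
cell's QUANTITATIVE reading of [I] p. 263 — print gives the LAST coupling qualitatively («C^∞ … (or analytic)») and for the older couplings only «depends also on all preceding coupling
constants» (p. 263 ∕ p. 264) — NOT a printed estimate; owners NODE A ∕ N09 (last coupling) ∕ N10 + def-W1's generator (older couplings); printed (1.18) ∕ (2.38) ∕ `AnalyticH`: N10 ∕
NODE A; readings + tails: NODE A ∕ N09; (G≈): NODE A ∕ def-W1, NOT typed here; law: NODE A ∕ N10 ∕ def-W1; (1.21): dag-n22-w3's road — REDUCED in §2, not proved); nothing of the
record is constructed or claimed to meet them; N22 is NOT discharged (typed 28∕28 · discharged 5∕27 UNCHANGED); K3⁸ OPEN and NOT claimed (no stub of 27366 is touched); NE9 is NOT IN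
PRINT for d = 4; no count claim (the chair's single count line is the only count); no summit statement is proved by this seat; one finite 𝕋⁴ programme at fixed ε — R4 closes the
CONDITIONAL rung `BalabanLadder.UV` only; NOTHING about the continuum limit, ℝ⁴, infinite volume, OS axioms, a mass gap or the Clay problem is proved or claimed by any of this.  A5∕A6:
§0 is unconditional; the `C^{1,1}` clause is inhabited non-degenerately by any `C²` family with the stated weighted bound (e.g. `t ↦ c(X)·t²·expNegInvGlue t`, dag-n22-c J47's real
trace); the letter rows are jointly satisfiable with `ℓ.Signs` (J42 §2); the kernel-fading road has dag-n22-w2's NON-DEGENERATE model (p627338); p616912 §4 inhabits the (G≈) letter's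
hypotheses at the EMPTY towers (DEGENERATE, declared); the law, (G≈)'s subject at the record, `θ` and the reading OF RECORD are LOCATED hypotheses — the filing is LOCATED, not a
discharge.  References (TYPES only, no cite tags on the Summit side): [I] = Bałaban, CMP 109 (1987) Thm 1 p. 259, (1.7) p. 261, §1 p. 263 with (1.18), (1.20)–(1.21) p. 264, §2 p. 266,
(2.12)–(2.13) p. 268, p. 282, (5.10) p. 293; [II] = CMP 116 (1988) (2.13)–(2.14) pp. 14–15, p. 15, Lemma 3 (2.38) p. 20, (2.41) p. 21; King, CMP 102 (1986) Lemma 4.5; [Chae1985] Ch. 15.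
-/

noncomputable section

open Filter Topology Metric Set
open scoped BigOperators

namespace YMDAG.N22.AtRecordOfPrintedSlots

open Literature.MathematicalPhysics.QuantumFieldTheory.Balaban1983to89
open Literature.MathematicalPhysics.QuantumFieldTheory.Balaban1983to89.T4Continuum (T4Family ULoop)
open Literature.MathematicalPhysics.QuantumFieldTheory.Balaban1983to89.T4OutputRate (Window NE9)
open Literature.MathematicalPhysics.QuantumFieldTheory.Balaban1983to89.B12TreeDecay (K₀ kappa₀)
open Literature.MathematicalPhysics.QuantumFieldTheory.Balaban1983to89.B12Decay510 (delta1)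
open Literature.MathematicalPhysics.QuantumFieldTheory.Balaban1983to89.B12Decay510Window (K₁)
open Literature.MathematicalPhysics.QuantumFieldTheory.Balaban1983to89.B12Decay510Torus (distCT nearT)
open Literature.MathematicalPhysics.QuantumFieldTheory.Balaban1983to89.TreeLengthTorus (TPt torusTreeLen)
open Literature.MathematicalPhysics.QuantumFieldTheory.Balaban1983to89.Node00 (siteOfInt Stage13Params Stage13HParams U3Letters₁₁ MatA)
open Literature.MathematicalPhysics.QuantumFieldTheory.Balaban1983to89.Node00.Sect2 (domCount domSys CPair)
open Literature.MathematicalPhysics.QuantumFieldTheory.Balaban1983to89.Node00.LocalizedSum17 (ReadingMaps Localizes17OfRecord₁₃)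
open Literature.MathematicalPhysics.QuantumFieldTheory.Balaban1983to89.Node00.W1 (ClusterTower ClusterStep box)
open Literature.MathematicalPhysics.QuantumFieldTheory.Balaban1983to89.Node00.U3OfKernels (histPrefix objectsOfRecord₁₃)
open Literature.MathematicalPhysics.QuantumFieldTheory.Balaban1983to89.Node00.U3KernelLetters (KernelStepRateOfRecord₁₃ PolLimitsExistOfRecord₁₃)
open YMDAG.UVSplit (N22At RateReading₁₃CoPH rateCarriersOfRecord₁₃CoPH)
open YMDAG.N22.WindowedOfCouplingHolo (differentiableOn_H_comp_of_analyticH histPrefix_mem_box)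
open YMDAG.N22.AtKernels (n22At_rateCarriers_of_kernels_pin_of_ne9 polLimitsExistOfRecord₁₃_of_twoPointGenerating)
open YMDAG.N22.KernelFading (ne9_EA_objectsOfRecord₁₃_of_kernelStepRate_termSecondDiff_outputBound)

open scoped Matrix.Norms.L2Operator

/-! ## §0 Real analysis: a `C^{1,1}` function has second differences `≤ L·d²` (no complex extension) -/

/-- ★ **SECOND DIFFERENCES FROM A LIPSCHITZ DERIVATIVE, ON THE REAL LINE.**  If `f : ℝ → ℂ` has derivative `f′ x` at every `x ∈ [t − d, t + d]` (`d > 0`) and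
`‖f′ x − f′ y‖ ≤ L·|x − y|` there, then `‖f(t + d) − 2 f(t) + f(t − d)‖ ≤ L·d²`: the symmetrised curve `s ↦ f(t+s) + f(t−s) − 2 f(t)` vanishes at `0` and has derivative
`f′(t+s) − f′(t−s)` of norm `≤ 2 L s` on `[0, d[`, and Mathlib's fencing lemma `image_norm_le_of_norm_deriv_right_le_deriv_boundary` compares it with `s ↦ L s²`.  The possibility-1
PRINT SHAPE of the coupling dependence ([I] p. 263 «a C^∞-function of g_{j−1} ∈ [0, γ]»), quantified as `C^{1,1}`; no holomorphy anywhere. -/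
theorem norm_secondDiff_le_of_derivLipschitz {f f' : ℝ → ℂ} {t d L : ℝ} (hd : 0 < d)
    (hf : ∀ x ∈ Icc (t - d) (t + d), HasDerivAt f (f' x) x)
    (hLip : ∀ x ∈ Icc (t - d) (t + d), ∀ y ∈ Icc (t - d) (t + d), ‖f' x - f' y‖ ≤ L * |x - y|) :
    ‖f (t + d) - 2 * f t + f (t - d)‖ ≤ L * d ^ 2 := by
  have hderivAt : ∀ s ∈ Icc (0 : ℝ) d,
      HasDerivAt (fun s : ℝ => f (t + s) + f (t - s) - 2 * f t) (f' (t + s) - f' (t - s)) s := by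
    intro s hs
    have h1 : HasDerivAt (fun s : ℝ => f (t + s)) (f' (t + s)) s :=
      HasDerivAt.comp_const_add t s (hf (t + s) ⟨by linarith [hs.1], by linarith [hs.2]⟩)
    have h2 : HasDerivAt (fun s : ℝ => f (t - s)) (-f' (t - s)) s :=
      HasDerivAt.comp_const_sub t s (hf (t - s) ⟨by linarith [hs.2], by linarith [hs.1]⟩)
    exact ((h1.add h2).sub_const (2 * f t)).congr_deriv (by ring)
  have hcont : ContinuousOn (fun s : ℝ => f (t + s) + f (t - s) - 2 * f t) (Icc 0 d) :=
    fun s hs => (hderivAt s hs).continuousAt.continuousWithinAt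
  have hderiv : ∀ s ∈ Ico (0 : ℝ) d,
      HasDerivWithinAt (fun s : ℝ => f (t + s) + f (t - s) - 2 * f t) (f' (t + s) - f' (t - s)) (Ici s) s :=
    fun s hs => (hderivAt s (Ico_subset_Icc_self hs)).hasDerivWithinAt
  have hbound : ∀ s ∈ Ico (0 : ℝ) d, ‖f' (t + s) - f' (t - s)‖ ≤ 2 * L * s := by
    intro s hs
    have h := hLip (t + s) ⟨by linarith [hs.1], by linarith [hs.2]⟩ (t - s) ⟨by linarith [hs.2], by linarith [hs.1]⟩
    have habs : |t + s - (t - s)| = 2 * s := by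
      rw [show t + s - (t - s) = 2 * s by ring]
      exact abs_of_nonneg (by linarith [hs.1])
    calc ‖f' (t + s) - f' (t - s)‖ ≤ L * |t + s - (t - s)| := h
      _ = 2 * L * s := by rw [habs]; ring
  have hB : ∀ x : ℝ, HasDerivAt (fun s : ℝ => L * s ^ 2) (2 * L * x) x := fun x =>
    ((hasDerivAt_pow 2 x).const_mul L).congr_deriv (by norm_num; ring)
  have h0 : ‖(fun s : ℝ => f (t + s) + f (t - s) - 2 * f t) 0‖ ≤ L * (0 : ℝ) ^ 2 := by
    have : f (t + 0) + f (t - 0) - 2 * f t = 0 := by rw [add_zero, sub_zero]; ring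
    simp only [this, norm_zero]
    simp
  have key := image_norm_le_of_norm_deriv_right_le_deriv_boundary hcont hderiv h0 hB hbound (right_mem_Icc.2 hd.le)
  have hφd : f (t + d) + f (t - d) - 2 * f t = f (t + d) - 2 * f t + f (t - d) := by ring
  simpa only [hφd] using key

variable (F : T4Family) (N : ℕ) [NeZero N]

/-! ## §1 `h9` and the N22 pin face from N18's kernel step rate + the REAL `C^{1,1}` datum + print's slots -/

open Classical in
/-- ★★★ **K3's `h9` WITH THE RECORD's GEOMETRIC MODULI FROM NODE N18's KERNEL STEP RATE + REAL `C^{1,1}` COUPLING DEPENDENCE + PRINT's SLOTS.**  J46 §2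
`ne9_EA_objectsOfRecord₁₃_of_kernelStepRate_termSecondDiff_outputBound` with its second-difference letter `hΔ` PRODUCED by §0 from the real datum `hC11` (`M₂ := L`) and its term-holomorphy
binder `hEhol` DISCHARGED by p621851 §0 (print's slots + holomorphic configuration readings; J46's ball clause by `ball_mem_sp_of_spaceClause`): `ℓ.Signs` + `0 < θ.γ` + node N18's
`KernelStepRateOfRecord₁₃ F N θ κ₅ ℓ.θ₅ C₅` + law + `hC11` + the printed output bound `hbd` + `Bound238` ∕ `AnalyticH` on the boxes + numerals + holomorphic readings + tails +
`PolLimitsExistOfRecord₁₃ F N θ` + rows ⟹ `NE9 ((objectsOfRecord₁₃ F N θ ℓ).EA 0) (Window θ.γ) ℓ.κ ℓ.moduli`.  LOCATED (hypothesis form); N22 NOT discharged. -/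
theorem ne9_EA_objectsOfRecord₁₃_of_kernelStepRate_derivLipschitz_analyticH (θ : Stage13Params F N) (ℓ : U3Letters₁₁) (hs : ℓ.Signs) (hγ : 0 < θ.γ)
    (hlim : PolLimitsExistOfRecord₁₃ F N θ) {κ₅ C₅ : ℝ} (hC₅ : 0 ≤ C₅) (h5 : KernelStepRateOfRecord₁₃ F N θ κ₅ ℓ.θ₅ C₅)
    {𝔸 : Type*} [NormedRing 𝔸] [NormedAlgebra ℂ 𝔸] (m' : ℕ) (M : ℕ) [NeZero M] (hM : M = F.L ^ m')
    (S : (K : ℕ) → ClusterTower (F.P K) 𝔸 M) (emb : ReadingMaps F (MatA N) 𝔸) (hloc : Localizes17OfRecord₁₃ F N θ S emb)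
    (sp : (K k : ℕ) → (domSys (F.P K) M (k + 1)).Dom → Set (CPair (F.P K) 𝔸))
    {κ κE δ₀ B₃ r L B A R r₁ : ℝ} (hL : 0 ≤ L)
    (hA : 0 ≤ A) (hr₁ : 0 ≤ r₁) (hrate : r₁ + 2 * (64 * Real.log 162) + 2 ≤ R) (hsmall : A * Real.exp (5 * r₁ + 1) * K₀ 64 8 * 9 * 64 ≤ 1)
    (hκ₀ : kappa₀ (4 * 2 ^ 4) (2 * 4) ≤ κ / 2) (hδ₀ : 0 < δ₀) (hB₃ : 0 ≤ B₃) (hr : 0 < r) (hB : 0 ≤ B) (hκE : κ ≤ κE)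
    (hC11 : ∀ (K k : ℕ) (i : Fin (k + 1)), ∀ g ∈ box θ.γ k, ∀ (X : (domSys (F.P K) M (k + 1)).Dom), ∀ φ ∈ sp K k X,
      ∃ fd : ℝ → ℂ, (∀ t ∈ Ioc (0 : ℝ) θ.γ, HasDerivAt (fun s : ℝ => ((S K) k).E (Function.update g i s) φ X) (fd t) t) ∧
        (∀ t ∈ Ioc (0 : ℝ) θ.γ, ∀ t' ∈ Ioc (0 : ℝ) θ.γ, ‖fd t - fd t'‖ ≤ L * Real.exp (-(κE * (domSys (F.P K) M (k + 1)).dj X)) * |t - t'|))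
    (hbd : ∀ g ∈ Window θ.γ, ∀ (K k : ℕ) (X : (domSys (F.P K) M (k + 1)).Dom), ∀ φ ∈ sp K k X,
      ‖((S K) k).E (histPrefix g k) φ X‖ ≤ B * Real.exp (-(κE * (domSys (F.P K) M (k + 1)).dj X)))
    (h238 : ∀ K k, ((S K) k).Bound238 (box θ.γ k) (sp K k) A R) (hAn : ∀ K k, ((S K) k).AnalyticH (box θ.γ k) (sp K k))
    (Ec : ℕ → ℕ → Type*) [∀ K k, NormedAddCommGroup (Ec K k)] [∀ K k, NormedSpace ℂ (Ec K k)]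
    (ι : letI := θ.instVβ₁; letI := θ.instVβ₂
      (K k : ℕ) → (domSys (F.P K) M (k + 1)).Dom → ((Fin (F.P K).d → Site (F.P K) (k + 1) → θ.Vβ) →L[ℝ] Ec K k))
    (Φ : (K k : ℕ) → (domSys (F.P K) M (k + 1)).Dom → Ec K k → CPair (F.P K) 𝔸)
    (U : (K k : ℕ) → (domSys (F.P K) M (k + 1)).Dom → Set (Ec K k)) (hU : ∀ K k X, IsOpen (U K k X)) (hrU : ∀ K k X, ball (0 : Ec K k) r ⊆ U K k X)
    (hΦhol : ∀ (K k : ℕ) (X : (domSys (F.P K) M (k + 1)).Dom), DifferentiableOn ℂ (Φ K k X) (U K k X))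
    (hΦemb : letI := θ.instVβ₁; letI := θ.instVβ₂
      ∀ (K k : ℕ) (X : (domSys (F.P K) M (k + 1)).Dom) (Bf : Fin (F.P K).d → Site (F.P K) (k + 1) → θ.Vβ),
        Φ K k X (ι K k X Bf) = emb K k (fun l t => NormedSpace.exp (θ.ρ8 (Bf l t))))
    (hΦsp : ∀ (K k : ℕ) (X : (domSys (F.P K) M (k + 1)).Dom), ∀ z ∈ U K k X, ∀ Z : (domSys (F.P K) M (k + 1)).Dom, Z.1 ⊆ X.1 → Φ K k X z ∈ sp K k Z)
    (w : (K k : ℕ) → (domSys (F.P K) M (k + 1)).Dom → Site (F.P K) (k + 1) → ℝ) (hw₀ : ∀ K k X t, 0 ≤ w K k X t)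
    (hw : letI := θ.instVβ₁; letI := θ.instVβ₂; letI := θ.instιβ
      ∀ (K k : ℕ) (X : (domSys (F.P K) M (k + 1)).Dom) (l : Fin (F.P K).d) (t : Site (F.P K) (k + 1)) (cc : θ.ιβ),
        ‖ι K k X (Pi.single l (Pi.single t (θ.bV cc)))‖ ≤ w K k X t)
    (htail : ∀ (K k : ℕ) (X : (domSys (F.P K) M (k + 1)).Dom) (t : Site (F.P K) (k + 1)),
      let e : Site (F.P K) (k + 1) → TPt 4 (domCount (F.P K) M (k + 1) * M) := fun x i => (ZMod.cast (x i) : ZMod (domCount (F.P K) M (k + 1) * M))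
      w K k X t ≤ B₃ * Real.exp (-δ₀ * distCT (domCount (F.P K) M (k + 1)) M (e t) (nearT (M := M) (e t) X)))
    (hκ₅ : delta1 δ₀ κ ((M : ℝ) * 4) ≤ κ₅) (hω : 0 < ℓ.ω) (hθω : ℓ.θ₅ ≤ ℓ.ω ^ 2) (hℓκ : ℓ.κ ≤ delta1 δ₀ κ ((M : ℝ) * 4))
    (hC₉ : (4 * (2 * C₅ / (1 - ℓ.θ₅) + 2 * ((16 * B * B₃ ^ 2 / r ^ 2) * Real.exp (delta1 δ₀ κ ((M : ℝ) * 4) * ((M : ℝ) * 4) * 3) * K₀ (4 * 2 ^ 4) (2 * 4) * K₁ 4 (δ₀ / 2))) / θ.γ +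
        ((16 * L * B₃ ^ 2 / r ^ 2) * Real.exp (delta1 δ₀ κ ((M : ℝ) * 4) * ((M : ℝ) * 4) * 3) * K₀ (4 * 2 ^ 4) (2 * 4) *
          K₁ 4 (δ₀ / 2)) * θ.γ / 2) / ℓ.ω ≤ ℓ.C₉) :
    NE9 ((objectsOfRecord₁₃ F N θ ℓ).EA 0) (Window θ.γ) ℓ.κ ℓ.moduli := by
  -- the term-level second-difference letter from the REAL `C^{1,1}` datum (§0), coordinate by coordinate
  have hΔ : ∀ (K k : ℕ) (i : Fin (k + 1)), ∀ g ∈ box θ.γ k, ∀ (X : (domSys (F.P K) M (k + 1)).Dom), ∀ φ ∈ sp K k X, ∀ t d : ℝ, 0 < d →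
      t - d ∈ Ioc (0 : ℝ) θ.γ → t + d ∈ Ioc (0 : ℝ) θ.γ →
        ‖((S K) k).E (Function.update g i (t + d)) φ X - 2 * ((S K) k).E (Function.update g i t) φ X + ((S K) k).E (Function.update g i (t - d)) φ X‖ ≤
          L * Real.exp (-(κE * (domSys (F.P K) M (k + 1)).dj X)) * d ^ 2 := by
    intro K k i g hg X φ hφ t d hd hm hp
    obtain ⟨fd, hfd, hfL⟩ := hC11 K k i g hg X φ hφ
    have hsub : ∀ x ∈ Icc (t - d) (t + d), x ∈ Ioc (0 : ℝ) θ.γ := fun x hx => ⟨lt_of_lt_of_le hm.1 hx.1, hx.2.trans hp.2⟩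
    exact norm_secondDiff_le_of_derivLipschitz (f := fun s : ℝ => ((S K) k).E (Function.update g i s) φ X) hd (fun x hx => hfd x (hsub x hx))
      (fun x hx y hy => hfL x (hsub x hx) y (hsub y hy))
  exact ne9_EA_objectsOfRecord₁₃_of_kernelStepRate_termSecondDiff_outputBound F N θ ℓ hs hγ hlim hC₅ h5 m' M hM S emb hloc sp hκ₀ hδ₀ hB₃ hr hL hB hκE hΔ hbd Ec ι Φ U
    hU hrU (differentiableOn_E_comp_of_printedSlots F S sp hA hr₁ hrate hsmall h238 hAn Ec Φ U hU hΦhol hΦsp) hΦemb (ball_mem_sp_of_spaceClause F sp Ec Φ U hrU hΦsp)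
    w hw₀ hw htail hκ₅ hω hθω hℓκ hC₉

open Classical in
/-- ★★★ **THE N22 PIN FACE FROM NODE N18's KERNEL STEP RATE + REAL `C^{1,1}` COUPLING DEPENDENCE + PRINT's SLOTS** — `N22At (rateCarriersOfRecord₁₃CoPH 𝔯 F θ hP g₀ os k).u3` for EVERY
`k` under `hpin`: §1's theorem at `θ.toStage13Params` fed to dag-n22-w3's `n22At_rateCarriers_of_kernels_pin_of_ne9`.  «N18's kernel step rate + real `C^{1,1}` dependence on each young
coupling + printed (1.18) + printed (2.38) + printed configuration analyticity + holomorphic minimizer readings + p. 282 tails + law + (1.21) + letter rows ⇒ `N22At` with the record's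
geometric moduli, every run length».  LOCATED (hypothesis form); N22 NOT discharged. -/
theorem n22At_rateCarriers_of_kernels_pin_of_kernelStepRate_derivLipschitz_analyticH (𝔯 : RateReading₁₃CoPH N) (θ : Stage13HParams F N) (hP : θ.Provisos₁₃CoPH F N)
    (g₀ : ℕ → ℝ) (os : List (ULoop F)) (ℓ : U3Letters₁₁) (hs : ℓ.Signs) (hγ : 0 < θ.γ)
    (hpin : (𝔯.lit F θ hP g₀ os).u3 = objectsOfRecord₁₃ F N θ.toStage13Params ℓ)
    (hlim : PolLimitsExistOfRecord₁₃ F N θ.toStage13Params) {κ₅ C₅ : ℝ} (hC₅ : 0 ≤ C₅) (h5 : KernelStepRateOfRecord₁₃ F N θ.toStage13Params κ₅ ℓ.θ₅ C₅)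
    {𝔸 : Type*} [NormedRing 𝔸] [NormedAlgebra ℂ 𝔸] (m' : ℕ) (M : ℕ) [NeZero M] (hM : M = F.L ^ m')
    (S : (K : ℕ) → ClusterTower (F.P K) 𝔸 M) (emb : ReadingMaps F (MatA N) 𝔸) (hloc : Localizes17OfRecord₁₃ F N θ.toStage13Params S emb)
    (sp : (K k : ℕ) → (domSys (F.P K) M (k + 1)).Dom → Set (CPair (F.P K) 𝔸))
    {κ κE δ₀ B₃ r L B A R r₁ : ℝ} (hL : 0 ≤ L)
    (hA : 0 ≤ A) (hr₁ : 0 ≤ r₁) (hrate : r₁ + 2 * (64 * Real.log 162) + 2 ≤ R) (hsmall : A * Real.exp (5 * r₁ + 1) * K₀ 64 8 * 9 * 64 ≤ 1)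
    (hκ₀ : kappa₀ (4 * 2 ^ 4) (2 * 4) ≤ κ / 2) (hδ₀ : 0 < δ₀) (hB₃ : 0 ≤ B₃) (hr : 0 < r) (hB : 0 ≤ B) (hκE : κ ≤ κE)
    (hC11 : ∀ (K k : ℕ) (i : Fin (k + 1)), ∀ g ∈ box θ.γ k, ∀ (X : (domSys (F.P K) M (k + 1)).Dom), ∀ φ ∈ sp K k X,
      ∃ fd : ℝ → ℂ, (∀ t ∈ Ioc (0 : ℝ) θ.γ, HasDerivAt (fun s : ℝ => ((S K) k).E (Function.update g i s) φ X) (fd t) t) ∧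
        (∀ t ∈ Ioc (0 : ℝ) θ.γ, ∀ t' ∈ Ioc (0 : ℝ) θ.γ, ‖fd t - fd t'‖ ≤ L * Real.exp (-(κE * (domSys (F.P K) M (k + 1)).dj X)) * |t - t'|))
    (hbd : ∀ g ∈ Window θ.γ, ∀ (K k : ℕ) (X : (domSys (F.P K) M (k + 1)).Dom), ∀ φ ∈ sp K k X,
      ‖((S K) k).E (histPrefix g k) φ X‖ ≤ B * Real.exp (-(κE * (domSys (F.P K) M (k + 1)).dj X)))
    (h238 : ∀ K k, ((S K) k).Bound238 (box θ.γ k) (sp K k) A R) (hAn : ∀ K k, ((S K) k).AnalyticH (box θ.γ k) (sp K k))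
    (Ec : ℕ → ℕ → Type*) [∀ K k, NormedAddCommGroup (Ec K k)] [∀ K k, NormedSpace ℂ (Ec K k)]
    (ι : letI := θ.instVβ₁; letI := θ.instVβ₂
      (K k : ℕ) → (domSys (F.P K) M (k + 1)).Dom → ((Fin (F.P K).d → Site (F.P K) (k + 1) → θ.Vβ) →L[ℝ] Ec K k))
    (Φ : (K k : ℕ) → (domSys (F.P K) M (k + 1)).Dom → Ec K k → CPair (F.P K) 𝔸)
    (U : (K k : ℕ) → (domSys (F.P K) M (k + 1)).Dom → Set (Ec K k)) (hU : ∀ K k X, IsOpen (U K k X)) (hrU : ∀ K k X, ball (0 : Ec K k) r ⊆ U K k X)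
    (hΦhol : ∀ (K k : ℕ) (X : (domSys (F.P K) M (k + 1)).Dom), DifferentiableOn ℂ (Φ K k X) (U K k X))
    (hΦemb : letI := θ.instVβ₁; letI := θ.instVβ₂
      ∀ (K k : ℕ) (X : (domSys (F.P K) M (k + 1)).Dom) (Bf : Fin (F.P K).d → Site (F.P K) (k + 1) → θ.Vβ),
        Φ K k X (ι K k X Bf) = emb K k (fun l t => NormedSpace.exp (θ.ρ8 (Bf l t))))
    (hΦsp : ∀ (K k : ℕ) (X : (domSys (F.P K) M (k + 1)).Dom), ∀ z ∈ U K k X, ∀ Z : (domSys (F.P K) M (k + 1)).Dom, Z.1 ⊆ X.1 → Φ K k X z ∈ sp K k Z)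
    (w : (K k : ℕ) → (domSys (F.P K) M (k + 1)).Dom → Site (F.P K) (k + 1) → ℝ) (hw₀ : ∀ K k X t, 0 ≤ w K k X t)
    (hw : letI := θ.instVβ₁; letI := θ.instVβ₂; letI := θ.instιβ
      ∀ (K k : ℕ) (X : (domSys (F.P K) M (k + 1)).Dom) (l : Fin (F.P K).d) (t : Site (F.P K) (k + 1)) (cc : θ.ιβ),
        ‖ι K k X (Pi.single l (Pi.single t (θ.bV cc)))‖ ≤ w K k X t)
    (htail : ∀ (K k : ℕ) (X : (domSys (F.P K) M (k + 1)).Dom) (t : Site (F.P K) (k + 1)),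
      let e : Site (F.P K) (k + 1) → TPt 4 (domCount (F.P K) M (k + 1) * M) := fun x i => (ZMod.cast (x i) : ZMod (domCount (F.P K) M (k + 1) * M))
      w K k X t ≤ B₃ * Real.exp (-δ₀ * distCT (domCount (F.P K) M (k + 1)) M (e t) (nearT (M := M) (e t) X)))
    (hκ₅ : delta1 δ₀ κ ((M : ℝ) * 4) ≤ κ₅) (hω : 0 < ℓ.ω) (hθω : ℓ.θ₅ ≤ ℓ.ω ^ 2) (hℓκ : ℓ.κ ≤ delta1 δ₀ κ ((M : ℝ) * 4))
    (hC₉ : (4 * (2 * C₅ / (1 - ℓ.θ₅) + 2 * ((16 * B * B₃ ^ 2 / r ^ 2) * Real.exp (delta1 δ₀ κ ((M : ℝ) * 4) * ((M : ℝ) * 4) * 3) * K₀ (4 * 2 ^ 4) (2 * 4) * K₁ 4 (δ₀ / 2))) / θ.γ +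
        ((16 * L * B₃ ^ 2 / r ^ 2) * Real.exp (delta1 δ₀ κ ((M : ℝ) * 4) * ((M : ℝ) * 4) * 3) * K₀ (4 * 2 ^ 4) (2 * 4) *
          K₁ 4 (δ₀ / 2)) * θ.γ / 2) / ℓ.ω ≤ ℓ.C₉) (k : ℕ) :
    N22At (rateCarriersOfRecord₁₃CoPH 𝔯 F θ hP g₀ os k).u3 :=
  n22At_rateCarriers_of_kernels_pin_of_ne9 𝔯 θ hP g₀ os ℓ hs hpin
    (ne9_EA_objectsOfRecord₁₃_of_kernelStepRate_derivLipschitz_analyticH F N θ.toStage13Params ℓ hs hγ hlim hC₅ h5 m' M hM S emb hloc sp hL hA hr₁ hrate hsmall hκ₀ hδ₀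
      hB₃ hr hB hκE hC11 hbd h238 hAn Ec ι Φ U hU hrU hΦhol hΦemb hΦsp w hw₀ hw htail hκ₅ hω hθω hℓκ hC₉) k

/-! ## §2 … with the (1.21) existence letter DISCHARGED by (G≈) (dag-n22-w3 g4's p616912 §3) -/

open Classical in
/-- ★★★ **K3's `h9`, REAL `C^{1,1}` EDITION, PRINT-LEVEL + (G≈)** — §1 with `hlim := polLimitsExistOfRecord₁₃_of_twoPointGenerating …` (p616912 §3; numerals `0 < κ ≤ r₁`, `κ₀(64,8) ≤ κ∕4`):
… + the small∕near class `lo` with its threshold clause + (G≈) on the bidisc `‖σ‖ < r₂` at rate `0 ≤ r₀ < 1` ⟹ `NE9 ((objectsOfRecord₁₃ F N θ ℓ).EA 0) (Window θ.γ) ℓ.κ ℓ.moduli`.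
NO (1.21)-existence, NO holomorphy-in-the-coupling and NO term-holomorphy hypothesis displayed.  LOCATED (hypothesis form); N22 NOT discharged. -/
theorem ne9_EA_objectsOfRecord₁₃_of_kernelStepRate_derivLipschitz_analyticH_twoPointGenerating (θ : Stage13Params F N) (ℓ : U3Letters₁₁) (hs : ℓ.Signs) (hγ : 0 < θ.γ)
    {κ₅ C₅ : ℝ} (hC₅ : 0 ≤ C₅) (h5 : KernelStepRateOfRecord₁₃ F N θ κ₅ ℓ.θ₅ C₅)
    {𝔸 : Type*} [NormedRing 𝔸] [NormedAlgebra ℂ 𝔸] (m' : ℕ) (M : ℕ) [NeZero M] (hM : M = F.L ^ m')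
    (S : (K : ℕ) → ClusterTower (F.P K) 𝔸 M) (emb : ReadingMaps F (MatA N) 𝔸) (hloc : Localizes17OfRecord₁₃ F N θ S emb)
    (sp : (K k : ℕ) → (domSys (F.P K) M (k + 1)).Dom → Set (CPair (F.P K) 𝔸))
    {κ κE δ₀ B₃ r L B A R r₁ r₂ r₀ : ℝ} (hL : 0 ≤ L)
    (hA : 0 ≤ A) (hr₁ : 0 ≤ r₁) (hrate : r₁ + 2 * (64 * Real.log 162) + 2 ≤ R) (hsmall : A * Real.exp (5 * r₁ + 1) * K₀ 64 8 * 9 * 64 ≤ 1)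
    (hκ0 : 0 < κ) (hκr : κ ≤ r₁) (hκ4 : kappa₀ (4 * 2 ^ 4) (2 * 4) ≤ κ / 2 / 2) (hδ₀ : 0 < δ₀) (hB₃ : 0 ≤ B₃) (hr : 0 < r) (hB : 0 ≤ B) (hκE : κ ≤ κE)
    (hC11 : ∀ (K k : ℕ) (i : Fin (k + 1)), ∀ g ∈ box θ.γ k, ∀ (X : (domSys (F.P K) M (k + 1)).Dom), ∀ φ ∈ sp K k X,
      ∃ fd : ℝ → ℂ, (∀ t ∈ Ioc (0 : ℝ) θ.γ, HasDerivAt (fun s : ℝ => ((S K) k).E (Function.update g i s) φ X) (fd t) t) ∧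
        (∀ t ∈ Ioc (0 : ℝ) θ.γ, ∀ t' ∈ Ioc (0 : ℝ) θ.γ, ‖fd t - fd t'‖ ≤ L * Real.exp (-(κE * (domSys (F.P K) M (k + 1)).dj X)) * |t - t'|))
    (hbd : ∀ g ∈ Window θ.γ, ∀ (K k : ℕ) (X : (domSys (F.P K) M (k + 1)).Dom), ∀ φ ∈ sp K k X,
      ‖((S K) k).E (histPrefix g k) φ X‖ ≤ B * Real.exp (-(κE * (domSys (F.P K) M (k + 1)).dj X)))
    (h238 : ∀ K k, ((S K) k).Bound238 (box θ.γ k) (sp K k) A R) (hAn : ∀ K k, ((S K) k).AnalyticH (box θ.γ k) (sp K k))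
    (Ec : ℕ → ℕ → Type*) [∀ K k, NormedAddCommGroup (Ec K k)] [∀ K k, NormedSpace ℂ (Ec K k)]
    (ι : letI := θ.instVβ₁; letI := θ.instVβ₂
      (K k : ℕ) → (domSys (F.P K) M (k + 1)).Dom → ((Fin (F.P K).d → Site (F.P K) (k + 1) → θ.Vβ) →L[ℝ] Ec K k))
    (Φ : (K k : ℕ) → (domSys (F.P K) M (k + 1)).Dom → Ec K k → CPair (F.P K) 𝔸)
    (U : (K k : ℕ) → (domSys (F.P K) M (k + 1)).Dom → Set (Ec K k)) (hU : ∀ K k X, IsOpen (U K k X)) (hrU : ∀ K k X, ball (0 : Ec K k) r ⊆ U K k X)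
    (hΦhol : ∀ (K k : ℕ) (X : (domSys (F.P K) M (k + 1)).Dom), DifferentiableOn ℂ (Φ K k X) (U K k X))
    (hΦemb : letI := θ.instVβ₁; letI := θ.instVβ₂
      ∀ (K k : ℕ) (X : (domSys (F.P K) M (k + 1)).Dom) (Bf : Fin (F.P K).d → Site (F.P K) (k + 1) → θ.Vβ),
        Φ K k X (ι K k X Bf) = emb K k (fun l t => NormedSpace.exp (θ.ρ8 (Bf l t))))
    (hΦsp : ∀ (K k : ℕ) (X : (domSys (F.P K) M (k + 1)).Dom), ∀ z ∈ U K k X, ∀ Z : (domSys (F.P K) M (k + 1)).Dom, Z.1 ⊆ X.1 → Φ K k X z ∈ sp K k Z)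
    (w : (K k : ℕ) → (domSys (F.P K) M (k + 1)).Dom → Site (F.P K) (k + 1) → ℝ) (hw₀ : ∀ K k X t, 0 ≤ w K k X t)
    (hw : letI := θ.instVβ₁; letI := θ.instVβ₂; letI := θ.instιβ
      ∀ (K k : ℕ) (X : (domSys (F.P K) M (k + 1)).Dom) (l : Fin (F.P K).d) (t : Site (F.P K) (k + 1)) (cc : θ.ιβ),
        ‖ι K k X (Pi.single l (Pi.single t (θ.bV cc)))‖ ≤ w K k X t)
    (htail : ∀ (K k : ℕ) (X : (domSys (F.P K) M (k + 1)).Dom) (t : Site (F.P K) (k + 1)),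
      let e : Site (F.P K) (k + 1) → TPt 4 (domCount (F.P K) M (k + 1) * M) := fun x i => (ZMod.cast (x i) : ZMod (domCount (F.P K) M (k + 1) * M))
      w K k X t ≤ B₃ * Real.exp (-δ₀ * distCT (domCount (F.P K) M (k + 1)) M (e t) (nearT (M := M) (e t) X)))
    (lo : (k K : ℕ) → (domSys (F.P K) M (k + 1)).Dom → Prop) [∀ k K, DecidablePred (lo k K)]
    (hlo : ∀ (k K : ℕ) (X : (domSys (F.P K) M (k + 1)).Dom), ¬ lo k K X →
      let e : Site (F.P K) (k + 1) → TPt 4 (domCount (F.P K) M (k + 1) * M) := fun x i => (ZMod.cast (x i) : ZMod (domCount (F.P K) M (k + 1) * M))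
      (K : ℝ) ≤ torusTreeLen X.1 ∨ (K : ℝ) ≤ distCT (domCount (F.P K) M (k + 1)) M (e (siteOfInt F K (k + 1) 0)) (nearT (M := M) (e (siteOfInt F K (k + 1) 0)) X))
    (hr₀ : r₀ < 1) (hr₀' : 0 ≤ r₀) (hr₂ : 0 < r₂) (hr₂r : (2 * B₃ + 1) * r₂ ≤ r)
    (hG : letI := θ.instVβ₁; letI := θ.instVβ₂; letI := θ.instιβ
      ∀ g ∈ Window θ.γ, ∀ (k : ℕ) (μ ν : Fin 4) (z : Fin 4 → ℤ), ∃ (K₀ : ℕ) (C : ℝ), ∀ K : ℕ, K₀ ≤ K → ∀ (cc : θ.ιβ) (σ : Fin 2 → ℂ), ‖σ‖ < r₂ →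
      ‖∑ X ∈ Finset.univ.filter (lo k (K + 1)), ((S (K + 1)) k).E (histPrefix g k) (Φ (K + 1) k X
          (σ 0 • ι (K + 1) k X (Pi.single (Fin.cast (F.P_d (K + 1)).symm μ) (Pi.single (siteOfInt F (K + 1) (k + 1) z) (θ.bV cc))) +
           σ 1 • ι (K + 1) k X (Pi.single (Fin.cast (F.P_d (K + 1)).symm ν) (Pi.single (siteOfInt F (K + 1) (k + 1) 0) (θ.bV cc))))) X -
        ∑ X ∈ Finset.univ.filter (lo k K), ((S K) k).E (histPrefix g k) (Φ K k X
          (σ 0 • ι K k X (Pi.single (Fin.cast (F.P_d K).symm μ) (Pi.single (siteOfInt F K (k + 1) z) (θ.bV cc))) +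
           σ 1 • ι K k X (Pi.single (Fin.cast (F.P_d K).symm ν) (Pi.single (siteOfInt F K (k + 1) 0) (θ.bV cc))))) X‖ ≤ C * r₀ ^ K)
    (hκ₅ : delta1 δ₀ κ ((M : ℝ) * 4) ≤ κ₅) (hω : 0 < ℓ.ω) (hθω : ℓ.θ₅ ≤ ℓ.ω ^ 2) (hℓκ : ℓ.κ ≤ delta1 δ₀ κ ((M : ℝ) * 4))
    (hC₉ : (4 * (2 * C₅ / (1 - ℓ.θ₅) + 2 * ((16 * B * B₃ ^ 2 / r ^ 2) * Real.exp (delta1 δ₀ κ ((M : ℝ) * 4) * ((M : ℝ) * 4) * 3) * K₀ (4 * 2 ^ 4) (2 * 4) * K₁ 4 (δ₀ / 2))) / θ.γ +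
        ((16 * L * B₃ ^ 2 / r ^ 2) * Real.exp (delta1 δ₀ κ ((M : ℝ) * 4) * ((M : ℝ) * 4) * 3) * K₀ (4 * 2 ^ 4) (2 * 4) *
          K₁ 4 (δ₀ / 2)) * θ.γ / 2) / ℓ.ω ≤ ℓ.C₉) :
    NE9 ((objectsOfRecord₁₃ F N θ ℓ).EA 0) (Window θ.γ) ℓ.κ ℓ.moduli :=
  ne9_EA_objectsOfRecord₁₃_of_kernelStepRate_derivLipschitz_analyticH F N θ ℓ hs hγ
    (polLimitsExistOfRecord₁₃_of_twoPointGenerating F N θ m' hM S emb hloc (fun _ k => box θ.γ k) (fun _ hg _ k => histPrefix_mem_box hg k) sp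
      hA hr₁ hκ0 hκr hκ4 hrate hsmall hB₃ hδ₀ hr h238 Ec ι Φ U hU hrU
      (fun K k _ hh X Z hZ => differentiableOn_H_comp_of_analyticH ((S K) k) (box θ.γ k) (sp K k) (hAn K k) hh (Φ K k X) (hΦhol K k X) X (hΦsp K k X) Z hZ)
      hΦemb hΦsp w hw₀ hw htail lo hlo hr₀ hr₀' hr₂ hr₂r hG)
    hC₅ h5 m' M hM S emb hloc sp hL hA hr₁ hrate hsmall (by linarith) hδ₀ hB₃ hr hB hκE hC11 hbd h238 hAn Ec ι Φ U hU hrU hΦhol hΦemb hΦsp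
    w hw₀ hw htail hκ₅ hω hθω hℓκ hC₉

open Classical in
/-- ★★★ **THE N22 PIN FACE, REAL `C^{1,1}` EDITION, PRINT-LEVEL + (G≈)** — `N22At (rateCarriersOfRecord₁₃CoPH 𝔯 F θ hP g₀ os k).u3` for EVERY `k` under `hpin`: §2's theorem at
`θ.toStage13Params` fed to dag-n22-w3's `n22At_rateCarriers_of_kernels_pin_of_ne9`.  LOCATED (hypothesis form); N22 NOT discharged. -/
theorem n22At_rateCarriers_of_kernels_pin_of_kernelStepRate_derivLipschitz_analyticH_twoPointGenerating (𝔯 : RateReading₁₃CoPH N) (θ : Stage13HParams F N)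
    (hP : θ.Provisos₁₃CoPH F N) (g₀ : ℕ → ℝ) (os : List (ULoop F)) (ℓ : U3Letters₁₁) (hs : ℓ.Signs) (hγ : 0 < θ.γ)
    (hpin : (𝔯.lit F θ hP g₀ os).u3 = objectsOfRecord₁₃ F N θ.toStage13Params ℓ)
    {κ₅ C₅ : ℝ} (hC₅ : 0 ≤ C₅) (h5 : KernelStepRateOfRecord₁₃ F N θ.toStage13Params κ₅ ℓ.θ₅ C₅)
    {𝔸 : Type*} [NormedRing 𝔸] [NormedAlgebra ℂ 𝔸] (m' : ℕ) (M : ℕ) [NeZero M] (hM : M = F.L ^ m')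
    (S : (K : ℕ) → ClusterTower (F.P K) 𝔸 M) (emb : ReadingMaps F (MatA N) 𝔸) (hloc : Localizes17OfRecord₁₃ F N θ.toStage13Params S emb)
    (sp : (K k : ℕ) → (domSys (F.P K) M (k + 1)).Dom → Set (CPair (F.P K) 𝔸))
    {κ κE δ₀ B₃ r L B A R r₁ r₂ r₀ : ℝ} (hL : 0 ≤ L)
    (hA : 0 ≤ A) (hr₁ : 0 ≤ r₁) (hrate : r₁ + 2 * (64 * Real.log 162) + 2 ≤ R) (hsmall : A * Real.exp (5 * r₁ + 1) * K₀ 64 8 * 9 * 64 ≤ 1)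
    (hκ0 : 0 < κ) (hκr : κ ≤ r₁) (hκ4 : kappa₀ (4 * 2 ^ 4) (2 * 4) ≤ κ / 2 / 2) (hδ₀ : 0 < δ₀) (hB₃ : 0 ≤ B₃) (hr : 0 < r) (hB : 0 ≤ B) (hκE : κ ≤ κE)
    (hC11 : ∀ (K k : ℕ) (i : Fin (k + 1)), ∀ g ∈ box θ.γ k, ∀ (X : (domSys (F.P K) M (k + 1)).Dom), ∀ φ ∈ sp K k X,
      ∃ fd : ℝ → ℂ, (∀ t ∈ Ioc (0 : ℝ) θ.γ, HasDerivAt (fun s : ℝ => ((S K) k).E (Function.update g i s) φ X) (fd t) t) ∧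
        (∀ t ∈ Ioc (0 : ℝ) θ.γ, ∀ t' ∈ Ioc (0 : ℝ) θ.γ, ‖fd t - fd t'‖ ≤ L * Real.exp (-(κE * (domSys (F.P K) M (k + 1)).dj X)) * |t - t'|))
    (hbd : ∀ g ∈ Window θ.γ, ∀ (K k : ℕ) (X : (domSys (F.P K) M (k + 1)).Dom), ∀ φ ∈ sp K k X,
      ‖((S K) k).E (histPrefix g k) φ X‖ ≤ B * Real.exp (-(κE * (domSys (F.P K) M (k + 1)).dj X)))
    (h238 : ∀ K k, ((S K) k).Bound238 (box θ.γ k) (sp K k) A R) (hAn : ∀ K k, ((S K) k).AnalyticH (box θ.γ k) (sp K k))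
    (Ec : ℕ → ℕ → Type*) [∀ K k, NormedAddCommGroup (Ec K k)] [∀ K k, NormedSpace ℂ (Ec K k)]
    (ι : letI := θ.instVβ₁; letI := θ.instVβ₂
      (K k : ℕ) → (domSys (F.P K) M (k + 1)).Dom → ((Fin (F.P K).d → Site (F.P K) (k + 1) → θ.Vβ) →L[ℝ] Ec K k))
    (Φ : (K k : ℕ) → (domSys (F.P K) M (k + 1)).Dom → Ec K k → CPair (F.P K) 𝔸)
    (U : (K k : ℕ) → (domSys (F.P K) M (k + 1)).Dom → Set (Ec K k)) (hU : ∀ K k X, IsOpen (U K k X)) (hrU : ∀ K k X, ball (0 : Ec K k) r ⊆ U K k X)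
    (hΦhol : ∀ (K k : ℕ) (X : (domSys (F.P K) M (k + 1)).Dom), DifferentiableOn ℂ (Φ K k X) (U K k X))
    (hΦemb : letI := θ.instVβ₁; letI := θ.instVβ₂
      ∀ (K k : ℕ) (X : (domSys (F.P K) M (k + 1)).Dom) (Bf : Fin (F.P K).d → Site (F.P K) (k + 1) → θ.Vβ),
        Φ K k X (ι K k X Bf) = emb K k (fun l t => NormedSpace.exp (θ.ρ8 (Bf l t))))
    (hΦsp : ∀ (K k : ℕ) (X : (domSys (F.P K) M (k + 1)).Dom), ∀ z ∈ U K k X, ∀ Z : (domSys (F.P K) M (k + 1)).Dom, Z.1 ⊆ X.1 → Φ K k X z ∈ sp K k Z)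
    (w : (K k : ℕ) → (domSys (F.P K) M (k + 1)).Dom → Site (F.P K) (k + 1) → ℝ) (hw₀ : ∀ K k X t, 0 ≤ w K k X t)
    (hw : letI := θ.instVβ₁; letI := θ.instVβ₂; letI := θ.instιβ
      ∀ (K k : ℕ) (X : (domSys (F.P K) M (k + 1)).Dom) (l : Fin (F.P K).d) (t : Site (F.P K) (k + 1)) (cc : θ.ιβ),
        ‖ι K k X (Pi.single l (Pi.single t (θ.bV cc)))‖ ≤ w K k X t)
    (htail : ∀ (K k : ℕ) (X : (domSys (F.P K) M (k + 1)).Dom) (t : Site (F.P K) (k + 1)),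
      let e : Site (F.P K) (k + 1) → TPt 4 (domCount (F.P K) M (k + 1) * M) := fun x i => (ZMod.cast (x i) : ZMod (domCount (F.P K) M (k + 1) * M))
      w K k X t ≤ B₃ * Real.exp (-δ₀ * distCT (domCount (F.P K) M (k + 1)) M (e t) (nearT (M := M) (e t) X)))
    (lo : (k K : ℕ) → (domSys (F.P K) M (k + 1)).Dom → Prop) [∀ k K, DecidablePred (lo k K)]
    (hlo : ∀ (k K : ℕ) (X : (domSys (F.P K) M (k + 1)).Dom), ¬ lo k K X →
      let e : Site (F.P K) (k + 1) → TPt 4 (domCount (F.P K) M (k + 1) * M) := fun x i => (ZMod.cast (x i) : ZMod (domCount (F.P K) M (k + 1) * M))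
      (K : ℝ) ≤ torusTreeLen X.1 ∨ (K : ℝ) ≤ distCT (domCount (F.P K) M (k + 1)) M (e (siteOfInt F K (k + 1) 0)) (nearT (M := M) (e (siteOfInt F K (k + 1) 0)) X))
    (hr₀ : r₀ < 1) (hr₀' : 0 ≤ r₀) (hr₂ : 0 < r₂) (hr₂r : (2 * B₃ + 1) * r₂ ≤ r)
    (hG : letI := θ.instVβ₁; letI := θ.instVβ₂; letI := θ.instιβ
      ∀ g ∈ Window θ.γ, ∀ (k : ℕ) (μ ν : Fin 4) (z : Fin 4 → ℤ), ∃ (K₀ : ℕ) (C : ℝ), ∀ K : ℕ, K₀ ≤ K → ∀ (cc : θ.ιβ) (σ : Fin 2 → ℂ), ‖σ‖ < r₂ →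
      ‖∑ X ∈ Finset.univ.filter (lo k (K + 1)), ((S (K + 1)) k).E (histPrefix g k) (Φ (K + 1) k X
          (σ 0 • ι (K + 1) k X (Pi.single (Fin.cast (F.P_d (K + 1)).symm μ) (Pi.single (siteOfInt F (K + 1) (k + 1) z) (θ.bV cc))) +
           σ 1 • ι (K + 1) k X (Pi.single (Fin.cast (F.P_d (K + 1)).symm ν) (Pi.single (siteOfInt F (K + 1) (k + 1) 0) (θ.bV cc))))) X -
        ∑ X ∈ Finset.univ.filter (lo k K), ((S K) k).E (histPrefix g k) (Φ K k X
          (σ 0 • ι K k X (Pi.single (Fin.cast (F.P_d K).symm μ) (Pi.single (siteOfInt F K (k + 1) z) (θ.bV cc))) +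
           σ 1 • ι K k X (Pi.single (Fin.cast (F.P_d K).symm ν) (Pi.single (siteOfInt F K (k + 1) 0) (θ.bV cc))))) X‖ ≤ C * r₀ ^ K)
    (hκ₅ : delta1 δ₀ κ ((M : ℝ) * 4) ≤ κ₅) (hω : 0 < ℓ.ω) (hθω : ℓ.θ₅ ≤ ℓ.ω ^ 2) (hℓκ : ℓ.κ ≤ delta1 δ₀ κ ((M : ℝ) * 4))
    (hC₉ : (4 * (2 * C₅ / (1 - ℓ.θ₅) + 2 * ((16 * B * B₃ ^ 2 / r ^ 2) * Real.exp (delta1 δ₀ κ ((M : ℝ) * 4) * ((M : ℝ) * 4) * 3) * K₀ (4 * 2 ^ 4) (2 * 4) * K₁ 4 (δ₀ / 2))) / θ.γ +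
        ((16 * L * B₃ ^ 2 / r ^ 2) * Real.exp (delta1 δ₀ κ ((M : ℝ) * 4) * ((M : ℝ) * 4) * 3) * K₀ (4 * 2 ^ 4) (2 * 4) *
          K₁ 4 (δ₀ / 2)) * θ.γ / 2) / ℓ.ω ≤ ℓ.C₉) (k : ℕ) :
    N22At (rateCarriersOfRecord₁₃CoPH 𝔯 F θ hP g₀ os k).u3 :=
  n22At_rateCarriers_of_kernels_pin_of_ne9 𝔯 θ hP g₀ os ℓ hs hpin
    (ne9_EA_objectsOfRecord₁₃_of_kernelStepRate_derivLipschitz_analyticH_twoPointGenerating F N θ.toStage13Params ℓ hs hγ hC₅ h5 m' M hM S emb hloc sp hL hA hr₁ hrate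
      hsmall hκ0 hκr hκ4 hδ₀ hB₃ hr hB hκE hC11 hbd h238 hAn Ec ι Φ U hU hrU hΦhol hΦemb hΦsp w hw₀ hw htail lo hlo hr₀ hr₀' hr₂ hr₂r hG hκ₅ hω hθω hℓκ hC₉) k

end YMDAG.N22.AtRecordOfPrintedSlots

end
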